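import Summits.CriticalPhenomena.SAWScalingLimit.Theorems.MassRatio.Negative.RowsA

/-!
# Crux `MassRatio` (stmt-CriticalPhenomena-8550) — load-bearing hypotheses, part 6: the rows family satisfies the rows clause and exhaustion, `a_δ → a`, `b_δ → b`; **`massRatio_frame_nonvacuous`** (the hypothesis frame of the crux is satisfiable) and the crux instantiated on it

Negative knowledge on the crux `MassRatio` (stmt-CriticalPhenomena-8550, route SAWDefectDecoherence r3),
written by the standing disprover (cdisprove, cycles 1–4). The series `MassRatio/Negative/*` does NOT
refute the crux (verdict: RESISTS — it is a pure exponent bet, predicted ratio `δ^{-25/48}` against the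
cut `δ^{-3/4}`); it proves which hypotheses of the crux are LOAD-BEARING (rows clause, `0 < ρ`,
`δ·mid(b_δ) → b`, exhaustion of compacts: each deleted ⇒ FALSE, by explicit admissible families in the
rectangle `D₀ = (-2,2)×(-1,1)` whose boundary mass at the target edge is starved EXACTLY by a bare
corridor), that the hypothesis frame is satisfiable (`massRatio_frame_nonvacuous`), and that the
`Nonempty`-SAW clause is implied by the others. Mechanism throughout: on a bare root-attached corridor
the self-avoiding walk is unique, so `|Z| = x_c^{length}` exactly, while a staircase walk certifies
`|Z(e₀)| ≥ x_c^{2 iK + 1}` at a mid-edge `e₀` of the compact `Kbox`; `x_c < 3/5` and Bernoulli finish.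
-/

namespace Summit.CriticalPhenomena.SAWScalingLimit.Theorems.MassRatio.Negative

open Literature.Probability.LatticeModels Literature.Probability.RandomPlanarGeometry.SAW
open Literature.Probability.RandomPlanarGeometry
open Summit.CriticalPhenomena.SAWScalingLimit.Theses.SAWDefectDecoherence

section RowsFamily

variable {δ : ℝ}

/-- **The rows clause**: inside the unit ball about `b`, membership in `ΛR` is `row ≥ m_δ`. [folklore] -/
theorem rows_ΛR (hδ : 0 < δ) (hδ1 : δ ≤ 1 / 100) :
    ∀ v : HexVertex, (δ : ℂ) * hexCenter v ∈ Metric.ball (D₀.pt 1) 1 →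
      (v ∈ ΛR δ ↔ mRow δ ≤ v.1 1) := by
  obtain ⟨-, hM0, -⟩ := params hδ hδ1
  intro v hv
  obtain ⟨h1, h2, h3, h4⟩ := ball_pt1 hv
  rw [← bv_row_pos v, bv_mem_ΛR]
  change _ ↔ mRow δ ≤ row v
  constructor
  · exact fun h => h.1
  · intro hm
    rw [re_scaled] at h1 h2
    have i1 := im_scaled_ge δ hδ.le v
    have hg := hgt_pos
    have hp : 0 < δ * hgt := by positivity
    -- `row < 0 ≤ M`
    have hrow : (row v : ℝ) + 1 / 3 < 0 := by
      by_contra hcon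
      have : 0 ≤ δ * hgt * ((row v : ℝ) + 1 / 3) := mul_nonneg hp.le (not_lt.1 hcon)
      linarith
    have hrow' : row v ≤ MRow δ := by
      have : (row v : ℝ) < 0 := by linarith
      have : row v < 0 := by exact_mod_cast this
      omega
    -- `0 ≤ pos ≤ P`
    have hpos1 : 0 ≤ pos v := by
      have : (0 : ℝ) < (pos v : ℝ) + 1 := by
        by_contra hcon
        have : δ * ((pos v : ℝ) + 1) ≤ 0 := mul_nonpos_of_nonneg_of_nonpos hδ.le (not_lt.1 hcon)
        linarith
      have : (-1 : ℝ) < pos v := by linarith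
      have : -1 < pos v := by exact_mod_cast this
      omega
    have hpos2 : pos v ≤ PPos δ := by
      have hlt : (pos v : ℝ) + 1 < 4 / δ := by
        rw [lt_div_iff₀ hδ]; nlinarith
      have : (pos v : ℝ) < 4 * (1 / δ) - 1 := by rw [show 4 * (1 / δ) = 4 / δ by ring]; linarith
      have := Int.lt_ceil.2 this
      unfold PPos; omega
    exact ⟨hm, hrow', by omega, hpos2⟩

/-- **Exhaustion** of compacts by the rows family (even with three rows to spare at the bottom). [folklore] -/
theorem exhaust_rows {K : Set ℂ} (hK : IsCompact K) (hKD : K ⊆ D₀.carrier) :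
    ∀ᶠ δ : ℝ in nhdsWithin 0 (Set.Ioi 0), ∀ v : HexVertex, (δ : ℂ) * hexCenter v ∈ K →
      mRow δ + 3 ≤ row v ∧ row v ≤ MRow δ ∧ -PPos δ ≤ pos v ∧ pos v ≤ PPos δ := by
  obtain ⟨ε, hε, hbox⟩ := compact_box hK hKD
  have hε' : 0 < min (1 / 100) (ε / 4) := lt_min (by norm_num) (by positivity)
  filter_upwards [Ioo_mem_nhdsGT hε'] with δ hδ
  obtain ⟨hδ0, hδ1⟩ := hδ
  have hδ100 : δ ≤ 1 / 100 := le_trans hδ1.le (min_le_left _ _)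
  have hδε : δ < ε / 4 := lt_of_lt_of_le hδ1 (min_le_right _ _)
  intro v hv
  obtain ⟨⟨r1, r2⟩, r3, r4⟩ := hbox _ hv
  rw [re_scaled] at r1 r2
  have i1 := im_scaled_ge δ hδ0.le v
  have i2 := im_scaled_le δ hδ0.le v
  have hg := hgt_pos
  have hg1 := hgt_lt
  have hp : 0 < δ * hgt := by positivity
  have e1 := mRow_height' hδ0
  have e2 := le_MRow δ
  have e3 := le_PPos δ
  have ht := t_mul hδ0
  have hs := s_mul hδ0
  refine ⟨?_, ?_, ?_, ?_⟩
  · by_contra hcon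
    have hr : (row v : ℝ) ≤ mRow δ + 2 := by
      have : row v ≤ mRow δ + 2 := by omega
      exact_mod_cast this
    have : ((δ : ℂ) * hexCenter v).im ≤ δ * hgt * ((mRow δ : ℝ) - 2 / 3) + δ * hgt * (10 / 3) := by
      nlinarith
    nlinarith
  · by_contra hcon
    have hr : (MRow δ : ℝ) + 1 ≤ row v := by
      have : MRow δ + 1 ≤ row v := by omega
      exact_mod_cast this
    nlinarith
  · by_contra hcon
    have hr : (pos v : ℝ) + 1 ≤ -PPos δ := by
      have : pos v + 1 ≤ -PPos δ := by omega
      exact_mod_cast this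
    nlinarith
  · by_contra hcon
    have hr : (PPos δ : ℝ) + 1 ≤ pos v := by
      have : PPos δ + 1 ≤ pos v := by omega
      exact_mod_cast this
    nlinarith

/-- `exhaust_ΛR`: rows-family (`ΛR`) lemma (MassRatio negative series). [folklore] -/
theorem exhaust_ΛR {K : Set ℂ} (hK : IsCompact K) (hKD : K ⊆ D₀.carrier) :
    ∀ᶠ δ : ℝ in nhdsWithin 0 (Set.Ioi 0), ∀ v : HexVertex, (δ : ℂ) * hexCenter v ∈ K →
      v ∈ ΛR δ := by
  filter_upwards [exhaust_rows hK hKD] with δ hδ v hv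
  obtain ⟨h1, h2, h3, h4⟩ := hδ v hv
  rw [← bv_row_pos v, bv_mem_ΛR]
  exact ⟨by omega, h2, h3, h4⟩

/-- The scaled root mid-edge: `δ·mid(a_δ) = (δ(pA+1)/2, δ·hgt·m)`. [folklore] -/
theorem scaled_aE (δ : ℝ) : (δ : ℂ) * hexMidpoint (aE δ) =
    ⟨δ * ((pA δ : ℝ) + 1) / 2, δ * hgt * (mRow δ : ℝ)⟩ := by
  have hodd : (pA δ - (mRow δ - 1)) % 2 = 1 := by have := pA_mod δ; omega
  apply Complex.ext
  · rw [Complex.re_ofReal_mul, aE, mid_re, pos_bv, pos_bv]; simp; ring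
  · rw [Complex.im_ofReal_mul, aE, mid_im, im_center_bv_odd hodd, im_center_bv_even (pA_mod δ)]
    simp; ring

/-- `scaled_bE`: rows-family (`ΛR`) lemma (MassRatio negative series). [folklore] -/
theorem scaled_bE (δ : ℝ) : (δ : ℂ) * hexMidpoint (bE δ) =
    ⟨δ * ((pB δ : ℝ) + 1) / 2, δ * hgt * (mRow δ : ℝ)⟩ := by
  have hodd : (pB δ - (mRow δ - 1)) % 2 = 1 := by have := pB_mod δ; omega
  apply Complex.ext
  · rw [Complex.re_ofReal_mul, bE, mid_re, pos_bv, pos_bv]; simp; ring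
  · rw [Complex.im_ofReal_mul, bE, mid_im, im_center_bv_odd hodd, im_center_bv_even (pB_mod δ)]
    simp; ring

/-- `tendsto_cmul`: rows-family (`ΛR`) lemma (MassRatio negative series). [folklore] -/
theorem tendsto_cmul (c : ℝ) :
    Filter.Tendsto (fun δ : ℝ => c * δ) (nhdsWithin 0 (Set.Ioi 0)) (nhds 0) := by
  have : Filter.Tendsto (fun δ : ℝ => c * δ) (nhds 0) (nhds (c * 0)) := Filter.tendsto_id.const_mul c
  rw [mul_zero] at this
  exact this.mono_left nhdsWithin_le_nhds

/-- `tendsto_two_mul`: rows-family (`ΛR`) lemma (MassRatio negative series). [folklore] -/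
theorem tendsto_two_mul : Filter.Tendsto (fun δ : ℝ => 2 * δ) (nhdsWithin 0 (Set.Ioi 0)) (nhds 0) :=
  tendsto_cmul 2

/-- `tendsto_aE`: rows-family (`ΛR`) lemma (MassRatio negative series). [folklore] -/
theorem tendsto_aE : Filter.Tendsto (fun δ : ℝ => (δ : ℂ) * hexMidpoint (aE δ))
    (nhdsWithin 0 (Set.Ioi 0)) (nhds (D₀.pt 0)) := by
  rw [D₀_pt0, tendsto_iff_dist_tendsto_zero]
  refine squeeze_zero' (Filter.Eventually.of_forall fun δ => dist_nonneg) ?_ tendsto_two_mul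
  filter_upwards [self_mem_nhdsWithin] with δ hδ
  rw [Set.mem_Ioi] at hδ
  rw [scaled_aE, Complex.dist_eq]
  refine (Complex.norm_le_abs_re_add_abs_im _).trans ?_
  simp only [Complex.sub_re, Complex.sub_im]
  obtain ⟨h1, h2⟩ := pA_re hδ
  have h3 := mRow_height hδ
  have h4 := mRow_height' hδ
  have hg := hgt_pos
  have hg' := hgt_lt
  have k1 : δ * hgt ≤ δ := by nlinarith
  have e1 : |δ * ((pA δ : ℝ) + 1) / 2 - -1| ≤ δ := abs_le.2 ⟨by linarith, by linarith⟩
  have e2 : |δ * hgt * (mRow δ : ℝ) - -1| ≤ δ := abs_le.2 ⟨by linarith, by linarith⟩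
  linarith

/-- `tendsto_bE`: rows-family (`ΛR`) lemma (MassRatio negative series). [folklore] -/
theorem tendsto_bE : Filter.Tendsto (fun δ : ℝ => (δ : ℂ) * hexMidpoint (bE δ))
    (nhdsWithin 0 (Set.Ioi 0)) (nhds (D₀.pt 1)) := by
  rw [D₀_pt1, tendsto_iff_dist_tendsto_zero]
  refine squeeze_zero' (Filter.Eventually.of_forall fun δ => dist_nonneg) ?_ tendsto_two_mul
  filter_upwards [self_mem_nhdsWithin] with δ hδ
  rw [Set.mem_Ioi] at hδ
  rw [scaled_bE, Complex.dist_eq]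
  refine (Complex.norm_le_abs_re_add_abs_im _).trans ?_
  simp only [Complex.sub_re, Complex.sub_im]
  obtain ⟨h1, h2⟩ := pB_re hδ
  have h3 := mRow_height hδ
  have h4 := mRow_height' hδ
  have hg := hgt_pos
  have hg' := hgt_lt
  have k1 : δ * hgt ≤ δ := by nlinarith
  have e1 : |δ * ((pB δ : ℝ) + 1) / 2 - 1| ≤ δ := abs_le.2 ⟨by linarith, by linarith⟩
  have e2 : |δ * hgt * (mRow δ : ℝ) - -1| ≤ δ := abs_le.2 ⟨by linarith, by linarith⟩
  linarith

/-- **NON-VACUITY of the crux's hypothesis frame.** The rectangle `D₀ = (-2,2)×(-1,1)` marked at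
`-1 - i`, `1 - i` (flat at `b` with `ρ = 1`), the rows family `ΛR`, `m_δ = mRow δ`, and the vertical
bottom mid-edges `a_δ = aE δ`, `b_δ = bE δ` satisfy EVERY hypothesis of `MassRatio` (and of the
five route targets `HexObservableLimit` sharing this frame). [folklore] -/
theorem massRatio_frame_nonvacuous :
    0 < (1 : ℝ) ∧
    D₀.carrier ∩ Metric.ball (D₀.pt 1) 1 = {z : ℂ | (D₀.pt 1).im < z.im} ∩ Metric.ball (D₀.pt 1) 1 ∧
    (∀ᶠ δ : ℝ in nhdsWithin 0 (Set.Ioi 0),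
      hexDomainSimplyConnected (ΛR δ) ∧ aE δ ∈ hexDomainBoundary (ΛR δ) ∧
      bE δ ∈ hexDomainBoundary (ΛR δ) ∧ Nonempty (HexMidEdgeSAW (ΛR δ) (aE δ) (bE δ)) ∧
      (hexGraph.induce ((ΛR δ : Finset HexVertex) : Set HexVertex)).Preconnected ∧
      (∀ v ∈ ΛR δ, (δ : ℂ) * hexCenter v ∈ D₀.carrier) ∧
      (∀ v : HexVertex, (δ : ℂ) * hexCenter v ∈ Metric.ball (D₀.pt 1) 1 →
        (v ∈ ΛR δ ↔ mRow δ ≤ v.1 1))) ∧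
    (∀ K : Set ℂ, IsCompact K → K ⊆ D₀.carrier → ∀ᶠ δ : ℝ in nhdsWithin 0 (Set.Ioi 0),
      ∀ v : HexVertex, (δ : ℂ) * hexCenter v ∈ K → v ∈ ΛR δ) ∧
    Filter.Tendsto (fun δ : ℝ => (δ : ℂ) * hexMidpoint (aE δ)) (nhdsWithin 0 (Set.Ioi 0))
      (nhds (D₀.pt 0)) ∧
    Filter.Tendsto (fun δ : ℝ => (δ : ℂ) * hexMidpoint (bE δ)) (nhdsWithin 0 (Set.Ioi 0))
      (nhds (D₀.pt 1)) := by
  refine ⟨one_pos, D₀_flat, ?_, fun K hK hKD => exhaust_ΛR hK hKD, tendsto_aE, tendsto_bE⟩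
  filter_upwards [Ioo_mem_nhdsGT (show (0:ℝ) < 1 / 100 by norm_num)] with δ hδ
  obtain ⟨hδ0, hδ1⟩ := hδ
  exact ⟨simplyConnected_ΛR hδ0 hδ1.le, aE_mem_boundary hδ0 hδ1.le, bE_mem_boundary hδ0 hδ1.le,
    nonempty_saw_ΛR hδ0 hδ1.le, preconnected_ΛR hδ0 hδ1.le, inside_ΛR hδ0 hδ1.le,
    rows_ΛR hδ0 hδ1.le⟩

/-- The crux instantiated on the rows family: what `MassRatio` asserts for `(D₀, 1, ΛR, mRow, aE, bE)`. [folklore] -/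
theorem massRatio_rows_family_bound
    (h : Summit.CriticalPhenomena.SAWScalingLimit.Theses.SAWDefectDecoherence.MassRatio) :
    ∀ K : Set ℂ, IsCompact K → K ⊆ D₀.carrier → ∃ C : ℝ, ∀ᶠ δ : ℝ in nhdsWithin 0 (Set.Ioi 0),
      δ ^ 2 * (∑ᶠ e ∈ {e : Sym2 HexVertex | e ∈ hexDomainMidEdges (ΛR δ) ∧
        (δ : ℂ) * hexMidpoint e ∈ K},
        ‖hexParafermionicObservable (ΛR δ) (aE δ) hexCriticalFugacity 0 e‖) ≤
      C * δ ^ (-(3 : ℝ) / 4) * ‖hexParafermionicObservable (ΛR δ) (aE δ) hexCriticalFugacity 0 (bE δ)‖ := by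
  obtain ⟨h1, h2, h3, h4, h5, h6⟩ := massRatio_frame_nonvacuous
  exact h D₀ 1 ΛR mRow aE bE h1 h2 h3 h4 h5 h6

end RowsFamily

end Summit.CriticalPhenomena.SAWScalingLimit.Theorems.MassRatio.Negative
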